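import Mathlib.Algebra.BigOperators.Ring.Finset
import Mathlib.Algebra.Order.BigOperators.Ring.Finset
import Mathlib.Data.Real.Basic
import Mathlib.Data.Fintype.Basic
import Mathlib.Data.Finset.Lattice.Fold
import Mathlib.Order.UpperLower.Basic
import Mathlib.Tactic.Linarith
import Mathlib.Tactic.Ring
import Mathlib.Tactic.Positivity
import HarnessLib
import HarnessLib.Audit

/-!
# `NoHeavyLowerTail` (crux stmt-CriticalPhenomena-4575), Sahi programme P4: discrete layer-cake inequalities
# for rectangle-dominated bilinear forms (block OR-step, file 1)

Support file (cell `prim-l12`, seat P4, generation 15; `--supports stmt-CriticalPhenomena-4575`).  No named facts, no sorries;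
standard axioms; def-free.

Let `Q` be a finite poset, `A : Q → Q → ℝ` a kernel and `ρ : Q → ℝ` diagonal weights such that for all UP-SETS `V, W`
`Σ_{s ∈ V} Σ_{s' ∈ W} A s s' ≤ Σ_{s ∈ V ∩ W} ρ s` ("rectangle domination"; in the application `A s s' = ν(s)ν(s')(1_G(s)+1_G(s')−u)`
and `ρ = R·1_G` is the retained mass of a flow certificate, and the hypothesis is its pair inequality).  Then
* `layer_cake₁`: for an up-set `V` and a monotone `ψ ≥ 0`, `Σ_{s∈V} Σ_{s'} A s s' ψ(s') ≤ Σ_{s∈V} ρ(s) ψ(s)`;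
* `layer_cake₂`: for monotone `f, g` with values in `[0,c_f]`, `[0,c_g]` and a kernel `K` on that box which is grounded
  (`K 0 y = 0`), monotone in the first variable and 2-increasing, `Σ_s Σ_{s'} A s s' K(f s, g s') ≤ Σ_s ρ(s) K(f s, g s)`.
Both are proved by induction on the number of values ("flattening the top layer"), i.e. they are the statement that
`K(f(s), g(s'))` is a nonnegative combination of rectangles `1_{f ≥ v}(s) 1_{g ≥ w}(s')` of up-sets.  Used by the principal block
OR-step (`…SahiE3BlockPair`) with `K(x,y) = xy` and with the kernel `K(x,y) = (xy − p(q−x)(q−y))⁺`.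
HOME prim-l12-p4/FROM-prim-l12-p4-gen15-BLOCK-OR-STEP.md.
-/

namespace Summit.CriticalPhenomena.PercolationContinuityZ3.Theorems.SahiE3LayerCake

open Finset
open scoped BigOperators

variable {Q : Type*} [Fintype Q] [DecidableEq Q] [PartialOrder Q]

omit [DecidableEq Q] in
/-- The super-level set `{s | c ≤ ψ s}` of a monotone function is an up-set. [folklore] -/
theorem isUpperSet_superlevel {ψ : Q → ℝ} (hψ : Monotone ψ) (c : ℝ) :
    IsUpperSet ((univ.filter fun s => c ≤ ψ s : Finset Q) : Set Q) := by
  intro s s' hss' hs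
  simp only [coe_filter, mem_univ, true_and, Set.mem_setOf_eq] at hs ⊢
  exact hs.trans (hψ hss')

omit [DecidableEq Q] [PartialOrder Q] in
/-- `univ` as an up-set (coercion form). [folklore] -/
theorem isUpperSet_univ' [Preorder Q] : IsUpperSet (((univ : Finset Q)) : Set Q) := by
  rw [coe_univ]; exact isUpperSet_univ

omit [Fintype Q] [PartialOrder Q] in
/-- `Σ_{s ∈ V} ρ(s)·[s ∈ W]·c = c · Σ_{s ∈ V ∩ W} ρ(s)`. [folklore] -/
theorem sum_mul_ite_mem (V W : Finset Q) (ρ : Q → ℝ) (c : ℝ) :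
    ∑ s ∈ V, ρ s * (if s ∈ W then c else 0) = c * ∑ s ∈ V ∩ W, ρ s := by
  simp_rw [mul_ite, mul_zero]
  rw [← Finset.sum_filter, Finset.filter_mem_eq_inter, Finset.mul_sum]
  exact Finset.sum_congr rfl fun s _ => mul_comm _ _

omit [PartialOrder Q] in
/-- `Σ_s [s ∈ W]·F(s) = Σ_{s ∈ W} F(s)`. [folklore] -/
theorem sum_ite_mem_univ (W : Finset Q) (F : Q → ℝ) :
    ∑ s, (if s ∈ W then F s else 0) = ∑ s ∈ W, F s := by
  rw [← Finset.sum_filter]; congr 1; ext s; simp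

/-- **One-dimensional layer cake.**  If `Σ_{V} Σ_{W} A ≤ Σ_{V ∩ W} ρ` for all up-sets `V, W`, then for every up-set `V` and every
monotone `ψ ≥ 0`: `Σ_{s∈V} Σ_{s'} A s s' ψ(s') ≤ Σ_{s∈V} ρ(s) ψ(s)`. [this work] -/
theorem layer_cake₁ (A : Q → Q → ℝ) (ρ : Q → ℝ)
    (hrect : ∀ V W : Finset Q, IsUpperSet (V : Set Q) → IsUpperSet (W : Set Q) →
      ∑ s ∈ V, ∑ s' ∈ W, A s s' ≤ ∑ s ∈ V ∩ W, ρ s)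
    (V : Finset Q) (hV : IsUpperSet (V : Set Q)) (ψ : Q → ℝ) (hψ : Monotone ψ) (hψ0 : ∀ s, 0 ≤ ψ s) :
    ∑ s ∈ V, ∑ s', A s s' * ψ s' ≤ ∑ s ∈ V, ρ s * ψ s := by
  suffices aux : ∀ (n : ℕ) (ψ : Q → ℝ), (univ.image ψ).card ≤ n → Monotone ψ → (∀ s, 0 ≤ ψ s) →
      ∑ s ∈ V, ∑ s', A s s' * ψ s' ≤ ∑ s ∈ V, ρ s * ψ s from aux _ ψ le_rfl hψ hψ0
  intro n
  induction n with
  | zero =>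
    intro ψ hcard _ _
    have hu : (univ : Finset Q) = ∅ := Finset.image_eq_empty.1 (Finset.card_eq_zero.1 (Nat.le_zero.1 hcard))
    have hV0 : V = ∅ := Finset.eq_empty_of_forall_notMem fun s _ => by
      have := Finset.mem_univ s; rw [hu] at this; exact absurd this (Finset.notMem_empty s)
    rw [hV0]; simp
  | succ n ih =>
    intro ψ hcard hψ hψ0
    rcases (univ : Finset Q).eq_empty_or_nonempty with hu | hne
    · have hV0 : V = ∅ := Finset.eq_empty_of_forall_notMem fun s _ => by
        have := Finset.mem_univ s; rw [hu] at this; exact absurd this (Finset.notMem_empty s)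
      rw [hV0]; simp
    -- the top value `m` and the top layer `W = {ψ = m}`
    set m : ℝ := univ.sup' hne ψ with hmdef
    have hm : ∀ s, ψ s ≤ m := fun s => Finset.le_sup' ψ (mem_univ s)
    set W : Finset Q := univ.filter fun s => m ≤ ψ s with hWdef
    have hWup : IsUpperSet (W : Set Q) := isUpperSet_superlevel hψ m
    have hWmem : ∀ s, s ∈ W ↔ ψ s = m := fun s => by
      rw [hWdef, mem_filter]; simp only [mem_univ, true_and]
      exact ⟨fun h => le_antisymm (hm s) h, fun h => h.ge⟩
    by_cases hall : ∀ s, ψ s = m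
    · -- constant function `ψ = m`
      obtain ⟨s₁, -, hs₁⟩ := Finset.exists_mem_eq_sup' hne ψ
      have hm0 : 0 ≤ m := by rw [hmdef, hs₁]; exact hψ0 s₁
      have key := hrect V univ hV isUpperSet_univ'
      rw [inter_univ] at key
      have eL : ∑ s ∈ V, ∑ s', A s s' * ψ s' = m * ∑ s ∈ V, ∑ s' ∈ (univ : Finset Q), A s s' := by
        rw [Finset.mul_sum]
        refine Finset.sum_congr rfl fun s _ => ?_
        rw [Finset.mul_sum]
        exact Finset.sum_congr rfl fun s' _ => by rw [hall s', mul_comm]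
      have eR : ∑ s ∈ V, ρ s * ψ s = m * ∑ s ∈ V, ρ s := by
        rw [Finset.mul_sum]
        exact Finset.sum_congr rfl fun s _ => by rw [hall s, mul_comm]
      rw [eL, eR]
      exact mul_le_mul_of_nonneg_left key hm0
    · -- a second value exists: `m₂ = max {ψ s | ψ s < m}`
      push Not at hall
      obtain ⟨s₀, hs₀⟩ := hall
      have hs₀lt : ψ s₀ < m := lt_of_le_of_ne (hm s₀) hs₀
      have hC : (univ.filter fun s => ψ s < m).Nonempty := ⟨s₀, by simp [hs₀lt]⟩
      set m₂ : ℝ := (univ.filter fun s => ψ s < m).sup' hC ψ with hm₂def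
      have hm₂lt : m₂ < m := by
        rw [hm₂def, Finset.sup'_lt_iff]; intro s hs; simpa using hs
      have hm₂ge : ∀ s, ψ s < m → ψ s ≤ m₂ := fun s hs => Finset.le_sup' ψ (by simp [hs])
      have hm₂0 : 0 ≤ m₂ := (hψ0 s₀).trans (hm₂ge s₀ hs₀lt)
      obtain ⟨s₂, hs₂C, hs₂⟩ := Finset.exists_mem_eq_sup' hC ψ
      -- the truncated function
      set ψ' : Q → ℝ := fun s => min (ψ s) m₂ with hψ'def
      have hψ'mono : Monotone ψ' := fun s s' h => min_le_min_right m₂ (hψ h)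
      have hψ'0 : ∀ s, 0 ≤ ψ' s := fun s => le_min (hψ0 s) hm₂0
      have hdec : ∀ s, ψ s = ψ' s + (if s ∈ W then m - m₂ else 0) := by
        intro s
        by_cases hs : s ∈ W
        · have h1 : ψ s = m := (hWmem s).1 hs
          rw [if_pos hs, hψ'def]; dsimp only; rw [h1, min_eq_right hm₂lt.le]; ring
        · have hlt : ψ s < m := lt_of_le_of_ne (hm s) fun h => hs ((hWmem s).2 h)
          rw [if_neg hs, hψ'def]; dsimp only; rw [min_eq_left (hm₂ge s hlt), add_zero]
      -- the number of values drops
      have hcard' : (univ.image ψ').card ≤ n := by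
        have hsub : univ.image ψ' ⊆ (univ.image ψ).erase m := by
          intro x hx
          rw [mem_image] at hx
          obtain ⟨s, -, rfl⟩ := hx
          rw [mem_erase]
          refine ⟨ne_of_lt (lt_of_le_of_lt (min_le_right _ _) hm₂lt), ?_⟩
          by_cases hs : ψ s < m
          · rw [hψ'def]; dsimp only; rw [min_eq_left (hm₂ge s hs)]; exact mem_image_of_mem _ (mem_univ s)
          · have h1 : ψ s = m := le_antisymm (hm s) (not_lt.1 hs)
            rw [hψ'def]; dsimp only; rw [h1, min_eq_right hm₂lt.le, hm₂def, hs₂]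
            exact mem_image_of_mem _ (mem_univ s₂)
        have hmem : m ∈ univ.image ψ := by
          obtain ⟨s₁, -, h⟩ := Finset.exists_mem_eq_sup' hne ψ
          rw [hmdef, h]; exact mem_image_of_mem _ (mem_univ s₁)
        calc (univ.image ψ').card ≤ ((univ.image ψ).erase m).card := card_le_card hsub
          _ = (univ.image ψ).card - 1 := card_erase_of_mem hmem
          _ ≤ n := by omega
      have IH := ih ψ' hcard' hψ'mono hψ'0
      have hVW := hrect V W hV hWup
      -- assemble
      have eL : ∑ s ∈ V, ∑ s', A s s' * ψ s' =
          ∑ s ∈ V, ∑ s', A s s' * ψ' s' + (m - m₂) * ∑ s ∈ V, ∑ s' ∈ W, A s s' := by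
        rw [Finset.mul_sum, ← Finset.sum_add_distrib]
        refine Finset.sum_congr rfl fun s _ => ?_
        rw [← univ_inter W, ← sum_mul_ite_mem univ W (A s) (m - m₂), ← Finset.sum_add_distrib]
        exact Finset.sum_congr rfl fun s' _ => by rw [hdec s']; ring
      have eR : ∑ s ∈ V, ρ s * ψ s = ∑ s ∈ V, ρ s * ψ' s + (m - m₂) * ∑ s ∈ V ∩ W, ρ s := by
        rw [← sum_mul_ite_mem V W ρ (m - m₂), ← Finset.sum_add_distrib]
        exact Finset.sum_congr rfl fun s _ => by rw [hdec s]; ring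
      rw [eL, eR]
      have := mul_le_mul_of_nonneg_left hVW (sub_nonneg.2 hm₂lt.le)
      linarith

/-- **Two-dimensional layer cake.**  Same rectangle hypothesis; `K` a kernel on `[0,c_f] × [0,c_g]` with `K 0 y = 0`, monotone in the
first variable and 2-increasing; `f, g` monotone with values in the box.  Then
`Σ_s Σ_{s'} A s s' K(f s, g s') ≤ Σ_s ρ(s) K(f s, g s)`. [this work] -/
theorem layer_cake₂ (A : Q → Q → ℝ) (ρ : Q → ℝ)
    (hrect : ∀ V W : Finset Q, IsUpperSet (V : Set Q) → IsUpperSet (W : Set Q) →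
      ∑ s ∈ V, ∑ s' ∈ W, A s s' ≤ ∑ s ∈ V ∩ W, ρ s)
    (K : ℝ → ℝ → ℝ) {cf cg : ℝ} (hK0 : ∀ y, 0 ≤ y → y ≤ cg → K 0 y = 0)
    (hKmono : ∀ x₁ x₂ y, 0 ≤ x₁ → x₁ ≤ x₂ → x₂ ≤ cf → 0 ≤ y → y ≤ cg → K x₁ y ≤ K x₂ y)
    (hK2 : ∀ x₁ x₂ y₁ y₂, 0 ≤ x₁ → x₁ ≤ x₂ → x₂ ≤ cf → 0 ≤ y₁ → y₁ ≤ y₂ → y₂ ≤ cg →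
      K x₂ y₁ - K x₁ y₁ ≤ K x₂ y₂ - K x₁ y₂)
    (f g : Q → ℝ) (hf : Monotone f) (hg : Monotone g) (hf0 : ∀ s, 0 ≤ f s) (hf1 : ∀ s, f s ≤ cf)
    (hg0 : ∀ s, 0 ≤ g s) (hg1 : ∀ s, g s ≤ cg) :
    ∑ s, ∑ s', A s s' * K (f s) (g s') ≤ ∑ s, ρ s * K (f s) (g s) := by
  -- the one-dimensional statement for the increments `y ↦ K x₂ y − K x₁ y`
  have incr : ∀ (x₁ x₂ : ℝ), 0 ≤ x₁ → x₁ ≤ x₂ → x₂ ≤ cf → ∀ (V : Finset Q), IsUpperSet (V : Set Q) →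
      ∑ s ∈ V, ∑ s', A s s' * (K x₂ (g s') - K x₁ (g s')) ≤ ∑ s ∈ V, ρ s * (K x₂ (g s) - K x₁ (g s)) := by
    intro x₁ x₂ h1 h2 h3 V hV
    refine layer_cake₁ A ρ hrect V hV (fun s => K x₂ (g s) - K x₁ (g s)) ?_ ?_
    · intro s s' hss'
      exact hK2 x₁ x₂ (g s) (g s') h1 h2 h3 (hg0 s) (hg hss') (hg1 s')
    · intro s
      exact sub_nonneg.2 (hKmono x₁ x₂ (g s) h1 h2 h3 (hg0 s) (hg1 s))
  suffices aux : ∀ (n : ℕ) (f : Q → ℝ), (univ.image f).card ≤ n → Monotone f → (∀ s, 0 ≤ f s) → (∀ s, f s ≤ cf) →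
      ∑ s, ∑ s', A s s' * K (f s) (g s') ≤ ∑ s, ρ s * K (f s) (g s) from aux _ f le_rfl hf hf0 hf1
  intro n
  induction n with
  | zero =>
    intro f hcard _ _ _
    have hu : (univ : Finset Q) = ∅ := Finset.image_eq_empty.1 (Finset.card_eq_zero.1 (Nat.le_zero.1 hcard))
    simp [hu]
  | succ n ih =>
    intro f hcard hf hf0 hf1
    rcases (univ : Finset Q).eq_empty_or_nonempty with hu | hne
    · simp [hu]
    set m : ℝ := univ.sup' hne f with hmdef
    have hm : ∀ s, f s ≤ m := fun s => Finset.le_sup' f (mem_univ s)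
    obtain ⟨s₁, -, hs₁⟩ := Finset.exists_mem_eq_sup' hne f
    have hm0 : 0 ≤ m := by rw [hmdef, hs₁]; exact hf0 s₁
    have hm1 : m ≤ cf := by rw [hmdef, hs₁]; exact hf1 s₁
    set W : Finset Q := univ.filter fun s => m ≤ f s with hWdef
    have hWup : IsUpperSet (W : Set Q) := isUpperSet_superlevel hf m
    have hWmem : ∀ s, s ∈ W ↔ f s = m := fun s => by
      rw [hWdef, mem_filter]; simp only [mem_univ, true_and]
      exact ⟨fun h => le_antisymm (hm s) h, fun h => h.ge⟩
    by_cases hall : ∀ s, f s = m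
    · -- constant: reduce to the increment `K m · − K 0 ·`
      have key := incr 0 m le_rfl hm0 hm1 univ isUpperSet_univ'
      have eL : ∑ s, ∑ s', A s s' * K (f s) (g s') = ∑ s, ∑ s', A s s' * (K m (g s') - K 0 (g s')) :=
        Finset.sum_congr rfl fun s _ => Finset.sum_congr rfl fun s' _ => by
          rw [hall s, hK0 (g s') (hg0 s') (hg1 s'), sub_zero]
      have eR : ∑ s, ρ s * K (f s) (g s) = ∑ s, ρ s * (K m (g s) - K 0 (g s)) :=
        Finset.sum_congr rfl fun s _ => by rw [hall s, hK0 (g s) (hg0 s) (hg1 s), sub_zero]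
      rw [eL, eR]; exact key
    · push Not at hall
      obtain ⟨s₀, hs₀⟩ := hall
      have hs₀lt : f s₀ < m := lt_of_le_of_ne (hm s₀) hs₀
      have hC : (univ.filter fun s => f s < m).Nonempty := ⟨s₀, by simp [hs₀lt]⟩
      set m₂ : ℝ := (univ.filter fun s => f s < m).sup' hC f with hm₂def
      have hm₂lt : m₂ < m := by
        rw [hm₂def, Finset.sup'_lt_iff]; intro s hs; simpa using hs
      have hm₂ge : ∀ s, f s < m → f s ≤ m₂ := fun s hs => Finset.le_sup' f (by simp [hs])
      have hm₂0 : 0 ≤ m₂ := (hf0 s₀).trans (hm₂ge s₀ hs₀lt)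
      obtain ⟨s₂, hs₂C, hs₂⟩ := Finset.exists_mem_eq_sup' hC f
      set f' : Q → ℝ := fun s => min (f s) m₂ with hf'def
      have hf'mono : Monotone f' := fun s s' h => min_le_min_right m₂ (hf h)
      have hf'0 : ∀ s, 0 ≤ f' s := fun s => le_min (hf0 s) hm₂0
      have hf'1 : ∀ s, f' s ≤ cf := fun s => (min_le_left _ _).trans (hf1 s)
      have hdec : ∀ s y, 0 ≤ y → y ≤ cg →
          K (f s) y = K (f' s) y + (if s ∈ W then K m y - K m₂ y else 0) := by
        intro s y _ _
        by_cases hs : s ∈ W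
        · have h1 : f s = m := (hWmem s).1 hs
          rw [if_pos hs, hf'def]; dsimp only; rw [h1, min_eq_right hm₂lt.le]; ring
        · have hlt : f s < m := lt_of_le_of_ne (hm s) fun h => hs ((hWmem s).2 h)
          rw [if_neg hs, hf'def]; dsimp only; rw [min_eq_left (hm₂ge s hlt), add_zero]
      have hcard' : (univ.image f').card ≤ n := by
        have hsub : univ.image f' ⊆ (univ.image f).erase m := by
          intro x hx
          rw [mem_image] at hx
          obtain ⟨s, -, rfl⟩ := hx
          rw [mem_erase]
          refine ⟨ne_of_lt (lt_of_le_of_lt (min_le_right _ _) hm₂lt), ?_⟩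
          by_cases hs : f s < m
          · rw [hf'def]; dsimp only; rw [min_eq_left (hm₂ge s hs)]; exact mem_image_of_mem _ (mem_univ s)
          · have h1 : f s = m := le_antisymm (hm s) (not_lt.1 hs)
            rw [hf'def]; dsimp only; rw [h1, min_eq_right hm₂lt.le, hm₂def, hs₂]
            exact mem_image_of_mem _ (mem_univ s₂)
        have hmem : m ∈ univ.image f := by rw [hmdef, hs₁]; exact mem_image_of_mem _ (mem_univ s₁)
        calc (univ.image f').card ≤ ((univ.image f).erase m).card := card_le_card hsub
          _ = (univ.image f).card - 1 := card_erase_of_mem hmem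
          _ ≤ n := by omega
      have IH := ih f' hcard' hf'mono hf'0 hf'1
      have hinc := incr m₂ m hm₂0 hm₂lt.le hm1 W hWup
      have eL : ∑ s, ∑ s', A s s' * K (f s) (g s') =
          ∑ s, ∑ s', A s s' * K (f' s) (g s') + ∑ s ∈ W, ∑ s', A s s' * (K m (g s') - K m₂ (g s')) := by
        rw [← sum_ite_mem_univ W, ← Finset.sum_add_distrib]
        refine Finset.sum_congr rfl fun s _ => ?_
        by_cases hs : s ∈ W
        · rw [if_pos hs, ← Finset.sum_add_distrib]
          exact Finset.sum_congr rfl fun s' _ => by rw [hdec s (g s') (hg0 s') (hg1 s'), if_pos hs]; ring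
        · rw [if_neg hs, add_zero]
          exact Finset.sum_congr rfl fun s' _ => by rw [hdec s (g s') (hg0 s') (hg1 s'), if_neg hs, add_zero]
      have eR : ∑ s, ρ s * K (f s) (g s) = ∑ s, ρ s * K (f' s) (g s) + ∑ s ∈ W, ρ s * (K m (g s) - K m₂ (g s)) := by
        rw [← sum_ite_mem_univ W, ← Finset.sum_add_distrib]
        refine Finset.sum_congr rfl fun s _ => ?_
        by_cases hs : s ∈ W
        · rw [if_pos hs, hdec s (g s) (hg0 s) (hg1 s), if_pos hs]; ring
        · rw [if_neg hs, hdec s (g s) (hg0 s) (hg1 s), if_neg hs]; ring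
      rw [eL, eR]
      linarith

end Summit.CriticalPhenomena.PercolationContinuityZ3.Theorems.SahiE3LayerCake
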